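import Summits.ABC.ABC.Theorems.DefiniteXiFreyModularityStubNineTransfer
import Literature.NumberTheory.Automorphic.CDTTheorem722
import Literature.NumberTheory.EllipticCurves.SzpiroFreyConductorProofs
import HarnessLib

/-!
# Stub-ideation companion k2 GEN 14 (family 2 — RESHAPE) for `stub_liftFive`

Crux `FreyModularity` (stmt-ABC-11340), route `DefiniteXi`, line `Lines/Sketch.lean` (sha 21576c53).
Plan page: `STUB-IDEAS-stub_liftFive-2.md` (gen 14).  Technique **T-γ: input-side rigidity** —
specialise the hypothesis `ρ.IsModular` of the stub to its ONLY provenance at the ONLY consumer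
(case B of `isModular_freyCurve_of_stubs`: the modular witness is the newform of the 3–5 switch
curve `W'`, level `N_{W'}`), and record that `N_{W'}` is rigid: squarefree at every odd `r ≠ 5`
(tree, k1-g15 transfer + Frey), equal 2-exponent when `E_(a,b)` is additive at `2` (H4), `25 ∤`
(k2-g8 `SwitchPlus`).  Consequence: the "minimal modular point" every R = T engine for the stub
needs (gen-12 E1 base case, gen-13 E2 single point) is `f_{W'}` lowered at the finitely many
primes `r ‖ N_{W'}`, `r ≠ 5`, where `ρ̄` is unramified — the `ℓ ≠ p`, `p ‖ N`, `ε = 1` slice of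
Ribet's theorem (H3), typeable today (`IsUnramifiedAt`; no Serre level/weight, no Carayol,
no Diamond-1995 refined Serre, no Khare–Wintenberger).

Everything unproved is a `def … : Prop`; the proved items are bookkeeping (L1, H5, H6, glue).
-/

noncomputable section

open scoped MatrixGroups NumberField

open Matrix Field IsDedekindDomain
open Literature.NumberTheory.EllipticCurves
open Literature.NumberTheory.EllipticCurves.ModularForms
open CongruenceSubgroup
open Literature.NumberTheory.Automorphic
open Literature.NumberTheory.Automorphic.BCDT
open Literature.NumberTheory.GaloisRepresentations
open Literature.NumberTheory.DiophantineGeometry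
open Rat.HeightOneSpectrum

namespace Summit.ABC.ABC.Cruxes.FreyModularity.StubIdeas.LiftFive2g14

/-- The registered stub, verbatim (for the kernel-checked pointers below). -/
def SigStubLiftFive : Prop :=
  ∀ (W : WeierstrassCurve ℚ) [W.IsElliptic] (ρ : ModPGaloisRep ℚ (ZMod 5) 2),
    W.IsTorsionGaloisRep 5 ρ → ρ.IsAbsIrreducibleOverSqrt 5 → ¬ 25 ∣ W.conductorNorm ℤ →
    ρ.IsModular → W.IsModularGaloisRepTate 5

/-! ## D1 / L1 — "`ρ̄` arises from `S₂(Γ₀(N))`" (weight 2, level `N`, trivial character) -/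

/-- **D1** `ρ̄` (mod 5, framed) arises from a newform of weight `2`, level `N` and trivial
nebentypus: the `w = 2`, `ε = 1`, level-explicit specialisation of `ModPGaloisRep.IsModular`
(`BCDTModularity`), same Frobenius/charpoly clause (`IsGaloisRepOfNewform1Int`). -/
def ArisesFromGammaZeroTwo (ρ : ModPGaloisRep ℚ (ZMod 5) 2) (N : ℕ) : Prop :=
  ∃ (_ : NeZero N) (f : CuspForm (Gamma1 N) 2) (K : Type) (_ : Field K)
    (_ : TopologicalSpace K) (_ : DiscreteTopology K) (j : ZMod 5 →+* K)
    (ι : coeffCharIntegers f →+* K),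
    IsNewform1 f ∧ nebentypus f = 1 ∧
      IsGaloisRepOfNewform1Int f ι {q | q ∣ N * ringChar (ZMod 5)}
        (FramedRep.baseChange j continuous_of_discreteTopology ρ)

/-- **L1** (XS, proved): forgetting level and character recovers the stub's hypothesis. -/
theorem isModular_of_arisesFromGammaZeroTwo {ρ : ModPGaloisRep ℚ (ZMod 5) 2} {N : ℕ}
    (h : ArisesFromGammaZeroTwo ρ N) : ρ.IsModular := by
  obtain ⟨hN, f, K, hK, hT, hD, j, ι, hnew, -, hρ⟩ := h
  exact ⟨N, hN, 2, f, K, hK, hT, hD, j, ι, by norm_num, hnew, hρ⟩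

/-! ## H2 — provenance: the consumer's modular witness has level `N_{W'}` and `ε = 1` -/

/-- **H2** (S): a modular (`BCDT.IsModular`) elliptic curve `W'` with `W'[5] ≅ ρ̄` makes `ρ̄`
arise from `S₂(Γ₀(N_{W'}))`.  Proof = the tree's level-explicit proof of
`IsModular.isModular_of_isTorsionGaloisRep` (`BCDTModularityModPProofs`) verbatim, keeping the
level `W'.conductorNorm ℤ` of `liftToGamma1 _ 2 f` and `nebentypus_liftToGamma1_holds`. -/
def ArisesFromCurveLevel : Prop :=
  ∀ (W' : WeierstrassCurve ℚ) [W'.IsElliptic] [NeZero (W'.conductorNorm ℤ)]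
    (ρ : ModPGaloisRep ℚ (ZMod 5) 2),
    BCDT.IsModular W' → W'.IsTorsionGaloisRep 5 ρ → ArisesFromGammaZeroTwo ρ (W'.conductorNorm ℤ)

/-! ## H3 — the `ℓ ≠ p`, `p ‖ N`, `ε = 1` slice of Ribet's level-lowering theorem -/

/-- **H3** (named fact to type as Literature, M): Ribet 1990 (Invent. 100) Thm 1.1 with Ribet 1991/94
("without multiplicity one", `ℓ` odd, `ε = 1`) — if irreducible `ρ̄` (mod 5) arises from
`S₂(Γ₀(N))`, `r ‖ N`, `r ≠ 5`, `25 ∤ N`, and `ρ̄` is unramified at `r` ("finite at `r`" for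
`r ≠ ℓ`), then `ρ̄` arises from `S₂(Γ₀(N / r))`.  Edixhoven (CSS 1997, Ch. VII) Thm 3.1/3.2.1;
Ribet–Stein, Lectures on Serre's conjectures §3.3.4–3.3.5 (key case, methods I/IV);
Darmon–Diamond–Taylor Thm 3.15 specialised. -/
def RibetLoweringAwayFromFive : Prop :=
  ∀ (ρ : ModPGaloisRep ℚ (ZMod 5) 2) (N : ℕ) (r : Nat.Primes),
    (r : ℕ) ≠ 5 → (r : ℕ) ∣ N → ¬ (r : ℕ) ^ 2 ∣ N → ¬ 25 ∣ N →
    FramedRep.IsIrreducible ρ → ρ.IsUnramifiedAt ((primesEquiv (R := 𝓞 ℚ)).symm r) →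
    ArisesFromGammaZeroTwo ρ N → ArisesFromGammaZeroTwo ρ (N / r)

/-! ## H4 — additive rigidity of the switch curve's conductor (`r ≠ 5`) -/

/-- **H4** (M, provable now GRANTED Ogg's wild formula for both curves): if `W[5] ≅ W'[5]` and
`W` is additive at a prime `p ≠ 5` then `v_p(N_W) = v_p(N_{W'})`.  Route: both curves additive
(k1-g15 `not_sq_dvd_conductorNorm_of_isTorsionGaloisRep`, both directions), tame parts `2 = 2`,
wild parts equal by `wildConductorExponent_eq_of_isTorsionGaloisRep_of_swan`
(`CDTSwanConductorProofs`), `f = ε + δ` (`conductorExponent_eq_tameConductorExponent_add_…_holds`),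
`factorization_conductorNorm_holds`, `conductorExponent_ringOfIntegers_eq`. -/
def AdditiveRigidity : Prop :=
  ∀ (W W' : WeierstrassCurve ℚ) [W.IsElliptic] [W'.IsElliptic] (ρ : ModPGaloisRep ℚ (ZMod 5) 2),
    W.IsTorsionGaloisRep 5 ρ → W'.IsTorsionGaloisRep 5 ρ →
    W.swanConductorAt_rationalTate_eq_wildConductorExponent 5 →
    W'.swanConductorAt_rationalTate_eq_wildConductorExponent 5 →
    ∀ p : ℕ, p.Prime → p ≠ 5 → p ^ 2 ∣ W.conductorNorm ℤ →
      (W.conductorNorm ℤ).factorization p = (W'.conductorNorm ℤ).factorization p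

/-! ## H5 — iterate H3 over the finitely many lowering primes (proved, bookkeeping) -/

/-- **H5** (XS, proved from H3): lower at a finite set `R` of primes `r ‖ N`, `r ≠ 5`, where `ρ̄` is
unramified. -/
theorem arisesFrom_div_prod_of_lowering (hR : RibetLoweringAwayFromFive)
    (ρ : ModPGaloisRep ℚ (ZMod 5) 2) (hirr : FramedRep.IsIrreducible ρ) (R : Finset Nat.Primes) :
    ∀ (N : ℕ), ¬ 25 ∣ N →
      (∀ r ∈ R, (r : ℕ) ≠ 5 ∧ (r : ℕ) ∣ N ∧ ¬ (r : ℕ) ^ 2 ∣ N ∧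
        ρ.IsUnramifiedAt ((primesEquiv (R := 𝓞 ℚ)).symm r)) →
      ArisesFromGammaZeroTwo ρ N → ArisesFromGammaZeroTwo ρ (N / ∏ r ∈ R, (r : ℕ)) := by
  classical
  induction R using Finset.induction_on with
  | empty => intro N _ _ h; simpa using h
  | insert r R hrR ih =>
    intro N h25 hR' hN
    rw [Finset.prod_insert hrR, ← Nat.div_div_eq_div_mul]
    obtain ⟨hr5, hrN, hr2, hur⟩ := hR' r (Finset.mem_insert_self r R)
    have hNr : ArisesFromGammaZeroTwo ρ (N / r) := hR ρ N r hr5 hrN hr2 h25 hirr hur hN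
    have hmul : N / r * r = N := Nat.div_mul_cancel hrN
    refine ih (N / r) ?_ ?_ hNr
    · intro h; exact h25 (hmul ▸ Dvd.dvd.mul_right h r)
    · intro r' hr'
      obtain ⟨h5', hN', h2', hu'⟩ := hR' r' (Finset.mem_insert_of_mem hr')
      have hne : (r' : ℕ) ≠ r := fun h ↦ hrR (Subtype.ext h ▸ hr')
      have hcop : Nat.Coprime (r' : ℕ) (r : ℕ) := (Nat.coprime_primes r'.2 r.2).mpr hne
      refine ⟨h5', ?_, ?_, hu'⟩
      · exact hcop.dvd_of_dvd_mul_right (hmul.symm ▸ hN')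
      · intro h; exact h2' (hmul ▸ Dvd.dvd.mul_right h r)

/-! ## H6 — Frey curves are semistable at every odd prime (proved) -/

/-- **H6** (XS, proved): `r` odd prime ⇒ `r² ∤ N(E_(a,b))` (`conductorNorm_freyCurve_dvd`:
`N ∣ 2⁸ · rad(ab(a+b))`). -/
theorem not_sq_dvd_conductorNorm_freyCurve_odd {a b : ℤ} (hab : IsCoprime a b)
    (h0 : a * b * (a + b) ≠ 0) {r : ℕ} (hr : r.Prime) (hr2 : r ≠ 2) :
    ¬ r ^ 2 ∣ (freyCurve a b).conductorNorm ℤ := by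
  intro hr2N
  have hdvd := conductorNorm_freyCurve_dvd_holds a b hab h0
  have h' : r ^ 2 ∣ 2 ^ 8 * (UniqueFactorizationMonoid.radical (a * b * (a + b))).natAbs :=
    hr2N.trans hdvd
  have hcop : Nat.Coprime (r ^ 2) (2 ^ 8) :=
    Nat.Coprime.pow 2 8 ((Nat.coprime_primes hr Nat.prime_two).mpr hr2)
  have hrad : r ^ 2 ∣ (UniqueFactorizationMonoid.radical (a * b * (a + b))).natAbs :=
    hcop.dvd_of_dvd_mul_left h'
  have hsq : Squarefree (UniqueFactorizationMonoid.radical (a * b * (a + b))).natAbs :=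
    Int.squarefree_natAbs.mpr UniqueFactorizationMonoid.squarefree_radical
  have hu : IsUnit r := hsq r (by rw [pow_two] at hrad; exact hrad)
  exact hr.ne_one (Nat.isUnit_iff.mp hu)

/-! ## Glue — the minimal modular point on the input side (proved from H2 + H3) -/

/-- **The input-side statement T-γ delivers to every engine**: for a Frey curve `E_(a,b)` with framed
`ρ̄ = E[5]` irreducible, a modular switch curve `W'` with `W'[5] ≅ ρ̄` and `25 ∤ N_{W'}`, and any
finite set `R` of primes `r ‖ N_{W'}`, `r ≠ 5`, at which `ρ̄` is unramified, `ρ̄` arises from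
`S₂(Γ₀(N_{W'} / ∏ R))` — granted H2 and H3. -/
theorem minimalModularPoint_of (hA : ArisesFromCurveLevel) (hR : RibetLoweringAwayFromFive)
    (W' : WeierstrassCurve ℚ) [W'.IsElliptic] [NeZero (W'.conductorNorm ℤ)]
    (ρ : ModPGaloisRep ℚ (ZMod 5) 2) (hirr : FramedRep.IsIrreducible ρ)
    (hmod : BCDT.IsModular W') (hρ' : W'.IsTorsionGaloisRep 5 ρ) (h25 : ¬ 25 ∣ W'.conductorNorm ℤ)
    (R : Finset Nat.Primes)
    (hRR : ∀ r ∈ R, (r : ℕ) ≠ 5 ∧ (r : ℕ) ∣ W'.conductorNorm ℤ ∧ ¬ (r : ℕ) ^ 2 ∣ W'.conductorNorm ℤ ∧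
      ρ.IsUnramifiedAt ((primesEquiv (R := 𝓞 ℚ)).symm r)) :
    ArisesFromGammaZeroTwo ρ (W'.conductorNorm ℤ / ∏ r ∈ R, (r : ℕ)) :=
  arisesFrom_div_prod_of_lowering hR ρ hirr R _ h25 hRR (hA W' ρ hmod hρ')

/-- **Squarefreeness of `N_{W'}` at odd `r ≠ 5`** (the `¬ r² ∣ N_{W'}` clause of `hRR` above), from
H6 and the k1-g15 transfer lemma, entered as the hypothesis `htr` in its registered shape
(`StubIdeasThreeImpTwo1G15.not_sq_dvd_conductorNorm_of_isTorsionGaloisRep W W' _ ρ hρ hρ'`). -/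
theorem not_sq_dvd_conductorNorm_switch_odd {a b : ℤ} (hab : IsCoprime a b)
    (h0 : a * b * (a + b) ≠ 0) (W' : WeierstrassCurve ℚ)
    (htr : ∀ p : ℕ, p.Prime → p ≠ 5 → ¬ p ^ 2 ∣ (freyCurve a b).conductorNorm ℤ →
      ¬ p ^ 2 ∣ W'.conductorNorm ℤ)
    {r : ℕ} (hr : r.Prime) (hr2 : r ≠ 2) (hr5 : r ≠ 5) : ¬ r ^ 2 ∣ W'.conductorNorm ℤ :=
  htr r hr hr5 (not_sq_dvd_conductorNorm_freyCurve_odd hab h0 hr hr2)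

/-! ## H7 (optional, S) — the obstruction behind refuter R1: no finite-inertia lift at a
potentially-multiplicative additive prime -/

/-- **H7** (S): over a field in which `5 ≠ 0`, an element of `GL₂` of order dividing `5` that is
conjugate to its square is trivial (eigenvalues `{λ, μ} = {λ², μ²}` among 5th roots of unity).
Consequence (page §4, R1): `ρ̄|_{G_{ℚ₂}} ≅ χ̄ ⊗ (1 t̄; 0 1)` with `t̄|_{I₂} ≠ 0` has NO characteristic-0
lift with finite inertia image, so DFG-minimality (`IsMinimallyRamifiedAt`, gen-12 type-`S`
predicate) is unattainable at such a prime and `2 ∈ S` is forced there. -/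
def OrderFiveNotConjSquare : Prop :=
  ∀ (F : Type) [Field F], (5 : F) ≠ 0 →
    ∀ g h : GL (Fin 2) F, g ^ 5 = 1 → h * g * h⁻¹ = g ^ 2 → g = 1

end Summit.ABC.ABC.Cruxes.FreyModularity.StubIdeas.LiftFive2g14
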